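import Literature.MathematicalPhysics.QuantumFieldTheory.Balaban1983to89.Step

/-!
# `Balaban1983to89.B12Eq16From13` — [Balaban1987RG1] p. 261 «In many considerations it is not necessary to separate
the terms of zeroth order from the remaining terms in the interaction, and then we write (1.6)» and «We can assume
that this representation holds for the functions 𝐄^{(j)} in (1.3) and (1.6), because the expansion of the
log Z^{(j−1)}(U_j) constructed in [16], implies, that we can represent this term in the form (1.7)» — PROVED at the
level of the small-field tower `Step.SFTower`: the ABSORPTION of a localized representation of `log Z^{(j)}` into the
terms `𝐄^{(j+1)}(X, ·)` turns the form (1.3) into the form (1.6) and preserves every inductive hypothesis of §1 (with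
`E₀ ↦ E₀ + Z₀` in (1.18))

HONEST FRAMING (cell `lit-balaban`, verbatim): statement-level skeleton of published theorems with citation tags;
proofs where landed; nothing here is a claim about the Yang–Mills mass gap.

CITATION HEADER.  T. Bałaban, *Renormalization group approach to lattice gauge field theories. I. Generation of
effective actions in a small field approximation and a coupling constant renormalization in four dimensions*,
Commun. Math. Phys. **109** (1987) 249–301, doi:10.1007/bf01215223 [Balaban1987RG1] (cell paper B12; [16] =
[Balaban1985UV3], CMP **102** (1985) 255–275, (41)/(47)).  PDF held: `paper:balaban1987-cmp109-rg-i-small-field`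
(journal page = PDF page + 248); pp. 256, 260–261, 263 [PDF 8, 12–13, 15] re-read this generation from the held text.
Unit `lit-balaban-r09` gen 8 (display owner of CMP 109; TAKING line `HOME/STATUS.md` 2026-08-21T06:41:13Z), HOME
`run/shared/lean/pub/lit-balaban/`; SKELETON rows `B12.Eq1.3`, `B12.Eq1.6`, `B12.Eq1.7` (all `typed-existing`:
`Step.SFTower.action13`, `action16`, `Etot`/`SFHyp.localDep`).

WHAT IS PRINTED (verbatim; `[…]` inside quotation marks is an omission by the author of this file).  p. 260 [PDF 12]:
*«The action has the following form  A_k(U_k) = −(1/g_k²)A(U_k) + Σ_{j=0}^{k−1} {−β_{j+1}(g_j)A(U_k) + [log Z^{(j)}(U_k)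
− log Z^{(j)}(1)] + [𝐄^{(j+1)}(g_j, U_k) − 𝐄^{(j+1)}(g_j, 1)]}. (1.3)  We have written explicitly terms of the order 0
in the coupling constants.»*  p. 261 [PDF 13]: *«In many considerations it is not necessary to separate the terms of
zeroth order from the remaining terms in the interaction, and then we write  A_k(U_k) = −(1/g_k²)A(U_k) +
Σ_{j=0}^{k−1} {−β_{j+1}(g_j)A(U_k) + [𝐄^{(j+1)}(g_j, U_k) − 𝐄^{(j+1)}(g_j, 1)]}. (1.6) […] The function
𝐄^{(j)}(g_{j−1}, U_j) is a result of an integration in the j-th step, after a subtraction of the previous action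
evaluated at U_j. We assume that it has the representation  𝐄^{(j)}(g_{j−1}, U_j) = Σ_{X∈𝐃_j} 𝐄^{(j)}(X, g_{j−1}, U_j).
(1.7)  Again, the term corresponding to a domain X depends on U_j restricted to X. We can assume that this
representation holds for the functions 𝐄^{(j)} in (1.3) and (1.6), because the expansion of the log Z^{(j−1)}(U_j)
constructed in [16], implies, that we can represent this term in the form (1.7).»*  p. 263 [PDF 15]: *«This assumption
is an easily verifiable statement for all explicitly defined terms in the action (1.3).»* (on (1.19)).

DICTIONARY print → Lean.  The tree's tower `Step.SFTower` carries BOTH printed forms (cell DIVERGENCE D-f2.3): `action13`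
(form (1.3): the zeroth-order terms `log Z^{(j)}` are the separate abstract datum `logZ : ℕ → GaugeField P 0 G → ℝ`)
and `action16` (form (1.6): no `logZ` term).  «the expansion of the log Z^{(j−1)}(U_j) constructed in [16] … in the
form (1.7)» ↦ a LOCALIZED REPRESENTATION DATUM `ζ : (i : ℕ) → (T.sys i).Dom → Φ → ℂ` placed at the index `i = j + 1`
of the term it joins, with the hypothesis `hζ : log Z^{(j)}(U) − log Z^{(j)}(1) = Re Σ_X ζ_{j+1}(X, (U, J(U))) −
Re Σ_X ζ_{j+1}(X, (1, J(1)))` for `j < k` (the subtraction at `U = 1` is the one printed in (1.3)); the absorbed tower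
`T.absorb ζ` has terms `𝐄^{(i)}(X, g, φ) + ζ_i(X, φ)` and `log Z ≡ 0`.  In [II] = [Balaban1988RG2Cluster] p. 21 the
two readings are the families `E^{(k+1)}(X)` (bound (I.1.18) with ½E₀) and `E^{(k+1)}(X) + Elog(X)` (bound with E₀)
— the tree's `B13.StepData.Ek1`/`Etot`, `B12StepObligation` Part A; the present file is the TOWER-SIDE counterpart:
the constant of (1.18) adds up, `E₀ ↦ E₀ + Z₀`.

WHAT IS PROVED (kernel-checked, no `sorry`, standard axioms; definitions with bodies: `absorb`; everything else
theorems).  `absorb_flow`/`_sys`/`_space`/`_act`/`_ofBackground`/`_agreeOn`/`_logZ`/`_E` (the components),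
`Etot_absorb` (`𝐄'^{(i)}(g, φ) = 𝐄^{(i)}(g, φ) + Σ_X ζ_i(X, φ)`), **`action16_absorb`** ((1.6) of the absorbed tower IS
(1.3) of the original one — the printed passage), `action13_absorb` (for the absorbed tower (1.3) = (1.6): nothing left
to separate), `Ek_absorb`; **`sfHyp_absorb`** (the inductive hypotheses of §1 at scale `k` transfer to the absorbed
tower — (2.15)/(1.22) clauses verbatim, (1.7) `localDep` and (1.19) `gaugeInv119` from the same clauses for `ζ`
(«Again, the term corresponding to a domain X depends on U_j restricted to X»; «easily verifiable statement for all
explicitly defined terms»), (1.18) `bound118` with `E₀ + Z₀` from a (1.18)-shaped bound `Z₀e^{−κd_i(X)}` for `ζ`),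
`sfHyp_absorb_zero` (`ζ = 0`: same constants), `exists_form16_of_form13` (packaging).  NOT here: the expansion of `log Z^{(j)}` itself ([16] (41)/(47) —
rows B10.Eq41/Eq47; [II] (2.41) `B13.LogHalfBound`); no `Prop` placeholder is introduced.
-/

namespace Literature.MathematicalPhysics.QuantumFieldTheory.Balaban1983to89.B12Eq16From13

open Literature.MathematicalPhysics.QuantumFieldTheory.Balaban1983to89
open Step GaugeField

noncomputable section

variable {P : Params} {G : Type*} [GaugeGroup G] {Φ 𝒢 : Type*}

/-! ## §1. The absorbed tower: `𝐄'^{(i)}(X, g, φ) = 𝐄^{(i)}(X, g, φ) + ζ_i(X, φ)`, `log Z' ≡ 0` -/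

/-- **p. 261: «it is not necessary to separate the terms of zeroth order from the remaining terms»** — the tower obtained
by ABSORBING a localized representation `ζ_i(X, φ)` (of `log Z^{(i−1)}`, placed at the index `i` of the term it joins;
«we can represent this term in the form (1.7)») into the terms `𝐄^{(i)}(X, g, φ)`, and forgetting the separate
zeroth-order datum. [cite: Balaban1987RG1, (1.6) p.261] -/
def absorb (T : SFTower P G Φ 𝒢) (ζ : (i : ℕ) → (T.sys i).Dom → Φ → ℂ) : SFTower P G Φ 𝒢 :=
  { T with
    E := fun i X g φ => T.E i X g φ + ζ i X φ
    logZ := fun _ _ => 0 }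

variable (T : SFTower P G Φ 𝒢) (ζ : (i : ℕ) → (T.sys i).Dom → Φ → ℂ)

/-- The absorbed tower has the same couplings and β-functions. [cite: Balaban1987RG1, (1.6) p.261] -/
@[simp] theorem absorb_flow : (absorb T ζ).flow = T.flow := rfl

/-- The absorbed tower has the same localization domains `𝐃_i`. [cite: Balaban1987RG1, (1.6) p.261] -/
@[simp] theorem absorb_sys : (absorb T ζ).sys = T.sys := rfl

/-- The absorbed tower has the same analyticity domains `𝐔ᶜ_i(X, α₀, α₁)`. [cite: Balaban1987RG1, (1.6) p.261] -/
@[simp] theorem absorb_space : (absorb T ζ).space = T.space := rfl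

/-- The absorbed tower has the same gauge action (1.10). [cite: Balaban1987RG1, (1.6) p.261] -/
@[simp] theorem absorb_act : (absorb T ζ).act = T.act := rfl

/-- The absorbed tower has the same substitution (1.9) `U ↦ (U, J(U))`. [cite: Balaban1987RG1, (1.6) p.261] -/
@[simp] theorem absorb_ofBackground : (absorb T ζ).ofBackground = T.ofBackground := rfl

/-- The absorbed tower has the same locality relation «depends on U_j restricted to X». [cite: Balaban1987RG1, (1.6) p.261] -/
@[simp] theorem absorb_agreeOn : (absorb T ζ).agreeOn = T.agreeOn := rfl

/-- The absorbed tower has no separate zeroth-order datum: `log Z' ≡ 0`. [cite: Balaban1987RG1, (1.6) p.261] -/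
@[simp] theorem absorb_logZ (i : ℕ) (U : GaugeField P 0 G) : (absorb T ζ).logZ i U = 0 := rfl

/-- The terms of the absorbed tower: `𝐄'^{(i)}(X, g, φ) = 𝐄^{(i)}(X, g, φ) + ζ_i(X, φ)`. [cite: Balaban1987RG1, (1.6) p.261] -/
@[simp] theorem absorb_E (i : ℕ) (X : (T.sys i).Dom) (g : ℝ) (φ : Φ) :
    (absorb T ζ).E i X g φ = T.E i X g φ + ζ i X φ := rfl

/-- The localized sums (1.7) of the absorbed tower: `𝐄'^{(i)}(g, φ) = 𝐄^{(i)}(g, φ) + Σ_X ζ_i(X, φ)`.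
[cite: Balaban1987RG1, (1.7) p.261] -/
theorem Etot_absorb (i : ℕ) (g : ℝ) (φ : Φ) :
    (absorb T ζ).Etot i g φ = T.Etot i g φ + ∑ X : (T.sys i).Dom, ζ i X φ := by
  unfold SFTower.Etot
  exact Finset.sum_add_distrib

/-! ## §2. (1.3) rewritten as (1.6) -/

/-- **THE PRINTED PASSAGE (1.3) → (1.6)**: if the zeroth-order terms have the localized representation
`log Z^{(j)}(U) − log Z^{(j)}(1) = Re Σ_X ζ_{j+1}(X, (U, J(U))) − Re Σ_X ζ_{j+1}(X, (1, J(1)))`, `j < k` («the expansion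
of the log Z^{(j−1)}(U_j) constructed in [16], implies, that we can represent this term in the form (1.7)»), then the
form (1.6) of the absorbed tower IS the form (1.3) of the original one: `A'_k(U) = A_k(U)` for every `U`.
[cite: Balaban1987RG1, (1.6) p.261] -/
theorem action16_absorb {k : ℕ}
    (hζ : ∀ j, j < k → ∀ U : GaugeField P 0 G,
      T.logZ j U - T.logZ j 1 =
        (∑ X : (T.sys (j+1)).Dom, ζ (j+1) X (T.ofBackground U)).re
          - (∑ X : (T.sys (j+1)).Dom, ζ (j+1) X (T.ofBackground 1)).re)
    (U : GaugeField P 0 G) : (absorb T ζ).action16 k U = T.action13 k U := by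
  unfold SFTower.action16 SFTower.action13
  simp only [absorb_flow, absorb_ofBackground, Etot_absorb, Complex.add_re]
  congr 1
  refine Finset.sum_congr rfl fun j hj => ?_
  rw [hζ j (Finset.mem_range.mp hj) U]
  ring

/-- For the absorbed tower there is nothing left to separate: its form (1.3) equals its form (1.6) (`log Z' ≡ 0`).
[cite: Balaban1987RG1, (1.3) p.260] -/
theorem action13_absorb (k : ℕ) (U : GaugeField P 0 G) : (absorb T ζ).action13 k U = (absorb T ζ).action16 k U := by
  unfold SFTower.action13 SFTower.action16
  simp only [absorb_logZ, sub_self, add_zero]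

/-- The sum `𝐄'_k` (0.23) of the absorbed tower = `𝐄_k` of the original one plus the absorbed zeroth-order terms.
[cite: Balaban1987RG1, (0.23) p.256] -/
theorem Ek_absorb (k : ℕ) (U : GaugeField P 0 G) :
    (absorb T ζ).Ek k U = T.Ek k U
      + ∑ j ∈ Finset.range k,
          ((∑ X : (T.sys (j+1)).Dom, ζ (j+1) X (T.ofBackground U)).re
            - (∑ X : (T.sys (j+1)).Dom, ζ (j+1) X (T.ofBackground 1)).re) := by
  unfold SFTower.Ek
  simp only [absorb_flow, absorb_ofBackground, Etot_absorb, Complex.add_re]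
  rw [← Finset.sum_add_distrib]
  refine Finset.sum_congr rfl fun j _ => ?_
  ring

/-- (1.6) of the absorbed tower = (1.6) of the original one plus the absorbed zeroth-order terms (so that with `hζ` it is
(1.3), `action16_absorb`). [cite: Balaban1987RG1, (1.6) p.261] -/
theorem action16_absorb_eq_add (k : ℕ) (U : GaugeField P 0 G) :
    (absorb T ζ).action16 k U = T.action16 k U
      + ∑ j ∈ Finset.range k,
          ((∑ X : (T.sys (j+1)).Dom, ζ (j+1) X (T.ofBackground U)).re
            - (∑ X : (T.sys (j+1)).Dom, ζ (j+1) X (T.ofBackground 1)).re) := by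
  rw [SFTower.action16_eq, SFTower.action16_eq, Ek_absorb]
  simp only [absorb_flow]
  ring

/-! ## §3. The inductive hypotheses of §1 transfer to the absorbed tower («We can assume that this representation
holds for the functions 𝐄^{(j)} in (1.3) and (1.6)»; «easily verifiable statement for all explicitly defined terms») -/

/-- **THE INDUCTIVE HYPOTHESES TRANSFER.**  If the tower satisfies the hypotheses of §1 at scale `k` with constants `c`,
and the absorbed pieces `ζ_i(X, ·)`, `1 ≤ i ≤ k`, satisfy the same three term-clauses — (1.7) locality («Again, the
term corresponding to a domain X depends on U_j restricted to X»), a (1.18)-shaped bound `|ζ_i(X, φ)| ≤ Z₀e^{−κd_i(X)}`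
on `𝐔ᶜ_i(X, α₀, α₁)`, and (1.19) gauge invariance («easily verifiable statement for all explicitly defined terms») —
then the absorbed tower satisfies the hypotheses of §1 at scale `k` with `E₀ + Z₀` in place of `E₀` (all other
constants unchanged). [cite: Balaban1987RG1, (1.18) p.263] -/
theorem sfHyp_absorb {c : SFConsts} {k : ℕ} (h : SFHyp T c k) {Z₀ : ℝ}
    (hloc : ∀ i, 1 ≤ i → i ≤ k → ∀ (X : (T.sys i).Dom) (φ ψ : Φ), T.agreeOn i X φ ψ → ζ i X φ = ζ i X ψ)
    (hbd : ∀ i, 1 ≤ i → i ≤ k → ∀ (X : (T.sys i).Dom) (φ : Φ), φ ∈ T.space i X c.α₀ c.α₁ →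
      ‖ζ i X φ‖ ≤ Z₀ * Real.exp (-c.κ * (T.sys i).dj X))
    (hinv : ∀ i, 1 ≤ i → i ≤ k → ∀ (X : (T.sys i).Dom) (u : 𝒢) (φ : Φ), ζ i X (T.act u φ) = ζ i X φ) :
    SFHyp (absorb T ζ) { c with E₀ := c.E₀ + Z₀ } k where
  rg := h.rg
  localDep := fun i h1 hi X g φ ψ hag => by
    simp only [absorb_E]
    rw [h.localDep i h1 hi X g φ ψ hag, hloc i h1 hi X φ ψ hag]
  bound118 := fun i h1 hi X g φ hg0 hgγ hφ => by
    simp only [absorb_E]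
    calc ‖T.E i X g φ + ζ i X φ‖ ≤ ‖T.E i X g φ‖ + ‖ζ i X φ‖ := norm_add_le _ _
      _ ≤ c.E₀ * Real.exp (-c.κ * (T.sys i).dj X) + Z₀ * Real.exp (-c.κ * (T.sys i).dj X) :=
          add_le_add (h.bound118 i h1 hi X g φ hg0 hgγ hφ) (hbd i h1 hi X φ hφ)
      _ = (c.E₀ + Z₀) * Real.exp (-c.κ * ((absorb T ζ).sys i).dj X) := by
          show _ = (c.E₀ + Z₀) * Real.exp (-c.κ * (T.sys i).dj X)
          ring
  spaceInv := h.spaceInv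
  gaugeInv119 := fun i h1 hi X g u φ => by
    simp only [absorb_E, absorb_act]
    rw [h.gaugeInv119 i h1 hi X g u φ, hinv i h1 hi X u φ]
  betaSmooth := h.betaSmooth
  betaBound := h.betaBound

/-- Absorbing nothing (`ζ = 0`) keeps the hypotheses with the same constants. [cite: Balaban1987RG1, (1.18) p.263] -/
theorem sfHyp_absorb_zero {c : SFConsts} {k : ℕ} (h : SFHyp T c k) :
    SFHyp (absorb T (fun _ _ _ => 0)) c k where
  rg := h.rg
  localDep := fun i h1 hi X g φ ψ hag => by
    simp only [absorb_E, add_zero]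
    exact h.localDep i h1 hi X g φ ψ hag
  bound118 := fun i h1 hi X g φ hg0 hgγ hφ => by
    simp only [absorb_E, add_zero]
    exact h.bound118 i h1 hi X g φ hg0 hgγ hφ
  spaceInv := h.spaceInv
  gaugeInv119 := fun i h1 hi X g u φ => by
    simp only [absorb_E, absorb_act, add_zero]
    exact h.gaugeInv119 i h1 hi X g u φ
  betaSmooth := h.betaSmooth
  betaBound := h.betaBound

/-- **The two forms together**: under the inductive hypotheses at scale `k` and a localized representation of the
zeroth-order terms with the three clauses, there is a tower (the absorbed one) whose form (1.6) is the given action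
(1.3) and which again satisfies the inductive hypotheses, with `E₀ + Z₀`. [cite: Balaban1987RG1, (1.6) p.261] -/
theorem exists_form16_of_form13 {c : SFConsts} {k : ℕ} (h : SFHyp T c k) {Z₀ : ℝ}
    (hζ : ∀ j, j < k → ∀ U : GaugeField P 0 G,
      T.logZ j U - T.logZ j 1 =
        (∑ X : (T.sys (j+1)).Dom, ζ (j+1) X (T.ofBackground U)).re
          - (∑ X : (T.sys (j+1)).Dom, ζ (j+1) X (T.ofBackground 1)).re)
    (hloc : ∀ i, 1 ≤ i → i ≤ k → ∀ (X : (T.sys i).Dom) (φ ψ : Φ), T.agreeOn i X φ ψ → ζ i X φ = ζ i X ψ)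
    (hbd : ∀ i, 1 ≤ i → i ≤ k → ∀ (X : (T.sys i).Dom) (φ : Φ), φ ∈ T.space i X c.α₀ c.α₁ →
      ‖ζ i X φ‖ ≤ Z₀ * Real.exp (-c.κ * (T.sys i).dj X))
    (hinv : ∀ i, 1 ≤ i → i ≤ k → ∀ (X : (T.sys i).Dom) (u : 𝒢) (φ : Φ), ζ i X (T.act u φ) = ζ i X φ) :
    ∃ T' : SFTower P G Φ 𝒢, T'.flow = T.flow ∧ T'.ofBackground = T.ofBackground ∧
      (∀ U, T'.action16 k U = T.action13 k U) ∧ SFHyp T' { c with E₀ := c.E₀ + Z₀ } k :=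
  ⟨absorb T ζ, rfl, rfl, action16_absorb T ζ hζ, sfHyp_absorb T ζ h hloc hbd hinv⟩

end

end Literature.MathematicalPhysics.QuantumFieldTheory.Balaban1983to89.B12Eq16From13
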